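import Literature.Probability.Process.ItoIntegralStopping
import HarnessLib

/-!
# Itô's theorem for Lipschitz SDEs: the hypothesis-free discharge

Topic `Analysis/FunctionSpaces`; sibling of `ItoProcesses.lean` (statement layer) and
`ItoProcessesProofs.lean` (the Picard/Gronwall proof of Revuz–Yor IX (2.1) modulo two named facts
on the Itô integral). This short file closes the loop:

* `lintegral_iSup_itoIntegral_sub_sq_le_holds` — the named fact **S2** of `ItoProcessesProofs`
  (Doob–Itô `L²` maximal inequality in difference form,
  `E[sup_{s ≤ t} (J_s - J'_s)²] ≤ 4 E ∫₀ᵗ (H_s - H'_s)² ds` for Itô integrals against the canonical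
  Brownian motion, raw Brownian filtration) is the specialisation of the generic theorem
  `Literature.Probability.Process.IsItoIntegral.lintegral_iSup_sub_sq_le` (`ItoIntegralStopping`) to
  `B = brownian`, using the discharged Brownian martingale facts
  `Literature.Probability.RandomPlanarGeometry.martingale_brownian_holds`,
  `Literature.Probability.RandomPlanarGeometry.martingale_brownian_sq_sub_holds` (`LocalMartingaleProofs`);
* `exists_itoIntegral_truncation_of_sq_integrable_holds` — the named fact **S4**
  (`(H 1_{[0,ρ]})·B = (H·B)^ρ` at an optional time `ρ`, square-integrable form) follows from the
  existence of the integral of the (progressive, square-integrable) truncated integrand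
  (`Literature.Probability.Process.exists_isItoIntegral_of_sq_integrable`, `ProgressiveDensity`) and
  the identification `Literature.Probability.Process.IsItoIntegral.ae_eq_stoppedProcess`
  (`ItoIntegralStopping`);
* `existsUnique_strongSolution_of_lipschitz_holds` — **Itô's existence and pathwise-uniqueness
  theorem for Lipschitz SDEs** driven by the canonical Brownian motion, i.e. the named fact
  `Literature.Analysis.FunctionSpaces.existsUnique_strongSolution_of_lipschitz` of `ItoProcesses.lean`
  (Revuz–Yor, Ch. IX, Thm (2.1); Itô 1951), by
  `existsUnique_strongSolution_of_lipschitz_of_facts` (`ItoProcessesProofs`) fed with S2 and S4.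

Nothing is stated anew here; see the module docstring of `ItoProcessesProofs.lean` for the
architecture of the proof (Picard iteration in `E[sup_{s≤t} |·|²]`, factorial bound, a.s. locally
uniform convergence; localisation at optional times of the raw filtration and Gronwall's lemma for
uniqueness) and its correspondence with the printed proof.

## References

* D. Revuz, M. Yor, *Continuous Martingales and Brownian Motion* (3rd ed., 1999), Ch. IX,
  Thm (2.1) (book p. 375); Ch. IV, Thm (2.2), Prop. (2.5), Prop. (2.10)(ii); Ch. II, Thm (1.7).
* K. Itô, *On stochastic differential equations*, Mem. Amer. Math. Soc. 4 (1951).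
-/

open MeasureTheory ProbabilityTheory Filter
open scoped NNReal ENNReal Topology

namespace Literature.Analysis.FunctionSpaces

open Literature.Probability.Process Literature.Probability.RandomPlanarGeometry

/-- **S2 holds**: the Doob–Itô `L²` maximal inequality in difference form for Itô integrals
against the canonical Brownian motion (raw Brownian filtration, pre-Wiener measure),
`E[sup_{s ≤ t} (J_s - J'_s)²] ≤ 4 E ∫₀ᵗ (H_s - H'_s)² ds` — discharge of the named fact
`lintegral_iSup_itoIntegral_sub_sq_le` by the generic `IsItoIntegral.lintegral_iSup_sub_sq_le`
(`B` a continuous square-integrable martingale with `B_t² - t` a martingale), the Brownian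
martingale facts being `martingale_brownian_holds` and `martingale_brownian_sq_sub_holds`.
Revuz–Yor, *Continuous Martingales and Brownian Motion* (1999), Ch. IV, Thm (2.2) and Ch. II,
Thm (1.7). [cite: RevuzYor1999, Ch. IV Thm (2.2) and Ch. II Thm (1.7)] -/
theorem lintegral_iSup_itoIntegral_sub_sq_le_holds : lintegral_iSup_itoIntegral_sub_sq_le := by
  intro H H' J J' hH hH' hJ hJ' t
  haveI := isProbabilityMeasure_preWienerMeasure'
  exact IsItoIntegral.lintegral_iSup_sub_sq_le martingale_brownian_holds
    martingale_brownian_sq_sub_holds memLp_two_brownian continuous_brownian hH hH' hJ hJ' t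

/-- **S4 holds**: stopping an Itô integral against the canonical Brownian motion at an optional
time `ρ` of the raw Brownian filtration is integrating the truncated integrand,
`(H 1_{[0,ρ]})·B = (H·B)^ρ` up to indistinguishability, whenever `H` is progressive and
`E ∫₀ᵗ (H 1_{[0,ρ]})² ds < ∞` for all `t` — discharge of the named fact
`exists_itoIntegral_truncation_of_sq_integrable`: the truncated integrand is progressive
(`isStronglyProgressive_trunc`) and square integrable, so its Itô integral exists
(`exists_isItoIntegral_of_sq_integrable`), and any such integral is indistinguishable from the
stopped process (`IsItoIntegral.ae_eq_stoppedProcess`).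
Revuz–Yor, *Continuous Martingales and Brownian Motion* (1999), Ch. IV, Prop. (2.5) and
Prop. (2.10)(ii). [cite: RevuzYor1999, Ch. IV Prop. (2.5) and Prop. (2.10)(ii)] -/
theorem exists_itoIntegral_truncation_of_sq_integrable_holds :
    exists_itoIntegral_truncation_of_sq_integrable := by
  intro H J ρ hH hJ hρ hfin
  haveI := isProbabilityMeasure_preWienerMeasure'
  obtain ⟨J', hJ', -, -⟩ :=
    exists_isItoIntegral_of_sq_integrable (isStronglyProgressive_trunc hH hρ) hfin
  exact ⟨J', hJ', hJ.ae_eq_stoppedProcess martingale_brownian_holds martingale_brownian_sq_sub_holds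
    memLp_two_brownian continuous_brownian (measurable_toNNReal_of_isStronglyProgressive hH) hρ hJ'⟩

/-- **Itô's existence and pathwise-uniqueness theorem for SDEs with Lipschitz coefficients**
driven by the canonical Brownian motion (discharge of the named fact
`existsUnique_strongSolution_of_lipschitz`): if `b, σ : ℝ → ℝ → ℝ` are jointly Borel, Lipschitz in
the space variable uniformly in time and locally bounded in time at `x = 0`, then for every `x₀`
the SDE `dX = b(t, X) dt + σ(t, X) dB`, `X₀ = x₀` has a solution adapted to the raw natural
filtration of `brownian` under the pre-Wiener measure, unique up to indistinguishability. The
proof is `existsUnique_strongSolution_of_lipschitz_of_facts` (`ItoProcessesProofs`: Picard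
iteration in `E[sup_{s≤t}|·|²]` with the factorial bound `Φ_T(Xⁿ⁻¹, Xⁿ) ≤ D CⁿTⁿ/n!` and a.s.
locally uniform convergence for existence; localisation at optional times of the raw filtration
and Gronwall's lemma for uniqueness) with its two Itô-integral inputs S2
(`lintegral_iSup_itoIntegral_sub_sq_le_holds`) and S4
(`exists_itoIntegral_truncation_of_sq_integrable_holds`).
K. Itô, Mem. Amer. Math. Soc. 4 (1951); Revuz–Yor, *Continuous Martingales and Brownian Motion*
(1999), Ch. IX, Thm (2.1). [cite: RevuzYor1999, Ch. IX Thm (2.1)] -/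
theorem existsUnique_strongSolution_of_lipschitz_holds : existsUnique_strongSolution_of_lipschitz :=
  existsUnique_strongSolution_of_lipschitz_of_facts lintegral_iSup_itoIntegral_sub_sq_le_holds
    exists_itoIntegral_truncation_of_sq_integrable_holds

end Literature.Analysis.FunctionSpaces
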